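import Summits.BirchSwinnertonDyer.BirchSwinnertonDyer.Theorems.GenusKolyvaginAtTwoMinimalTwinBSDTwoKrizLiAnchorWall
import Summits.BirchSwinnertonDyer.BirchSwinnertonDyer.Theorems.GenusKolyvaginAtTwoMinimalTwinBSDTwoOrdinaryTwist
import HarnessLib

/-!
# Route `GenusKolyvaginAtTwo`, crux U₂ `MinimalTwinBSDTwo` (stmt-BirchSwinnertonDyer-22985), LINE 23 «twin_swap»: THE KRIZ–LI ANCHOR ROAD KEYED ON THE
# SUPERSINGULAR WALL ITEM ALONE — for a rank-one (★)-anchor `V` that is GOOD SUPERSINGULAR at `2` (every good-at-`2` row of Kriz–Li's Table 1: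
# (★) forces `|Ẽ^{ns}(𝔽₂)| = 3 − a₂` odd, i.e. `a₂` even) and a Heegner field with `d_K ≡ 1 (mod 4)`, the companion `V^{(d_K)}` is again good
# SUPERSINGULAR at `2`, so `BSD(·, 2)` on the whole packet needs only WALL item 19097 `SupersingularRankZeroAtTwo` (displayed, unfolded) + PRINT

Seat `bsd-line-gk2-p2` g34 (PROVER 2/3, cell `bsd-f1-sign2`; LINE 23 holder), `--supports stmt-BirchSwinnertonDyer-22985` (helper; closes nothing).
THEOREMS ONLY (0 `def`, 0 `sorry`); standard axioms; route-independent (no Theses import: the supersingular wall row is DISPLAYED in exactly the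
unfolded shape of `Summit.…Theses.ByReductionTypeAtTwo.SupersingularRankZeroAtTwo`, so a consumer feeds that item by name with no glue).
HONEST FRAMING (D-0014/D-0036): sharpening of `…KrizLiAnchorWall.lean` (this seat): there the companion's `BSD(2)` came from S1′ = all four WALL
row-1 items; here the reduction type of the companion at `2` is PINNED — `GoodSS` travels along twists by `d ≡ 1 (mod 4)` (§1, from the sibling seat's
transport lemmas `OrdinaryTwistAtTwo.hasGoodReductionAtPrime_two_of_smul_quadraticTwist_of_emod_four_eq_one` /
`isOrdinaryAt_two_iff_of_smul_quadraticTwist_of_emod_four_eq_one`, p-file `…OrdinaryTwist.lean`, gk2-p3 g6) — so ONE wall item suffices: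
* §1 `goodSS_two_of_smul_quadraticTwist_of_emod_four_eq_one` (+ `goodSS_two_of_even_a₁`: a globally minimal integer model good at `2` with EVEN `a₁`
  is supersingular at `2`, Silverman V.4 via `OrdinaryTwistAtTwo.isOrdinaryAt_two_iff_odd_a₁`).
* §2 ★ `krizLi_bsdp_two_of_twist_of_conductor_lt_of_ssWall` — `BSDp W′ 2` on the packet from: the supersingular wall row (`hSS`, displayed), `GoodSS V 2`,
  `d_K ≡ 1 (mod 4)`, and the inputs of the wall-keyed road (`N(V) < 5000`, `¬CM`, `r_an(V) = 1`, `V(ℚ)[2] = 0`, Heegner field, (★)-datum, local clause;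
  BY NAME Thm 5.1 (2), Thm 4.3, Creutz–Miller).  §3 the U₂-keyed sorting `rankOneMembers_of_ssWall` / `rankZeroCompanions_of_ssWall`.
Instances: `…KrizLiAnchorsSupersingularWall.lean` (anchors `101a1`, `131a1`, `163a1`: `a₁ = 0`).  **BSD is NOT proved by any of this; U₂ is NOT
proved; the supersingular wall (19097) is OPEN; no item is closed.**

References: [KrizLi2019] Thm 5.1 (2), Thm 4.3, §6 Ex. 6.2 («the formal group of E at 2 cannot be isomorphic to 𝔾_m»), Table 1; [CreutzMiller2012]
Thm 1.1; [SilvermanAEC2009] V.4, VII.1 Prop. 1.3(b), X.2 Prop. 2.4, App. C §11; [Pal2012] Prop. 2.5.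
-/

set_option autoImplicit false
-- the Theorems namespace of this sub repeats the summit name by design (D-0017 nested layout)
set_option linter.dupNamespace false

noncomputable section

open scoped Classical

open WeierstrassCurve NumberField Literature.NumberTheory.EllipticCurves
  Literature.NumberTheory.EllipticCurves.ModularForms
  Literature.NumberTheory.EllipticCurves.Rank1Residual
  Literature.NumberTheory.EllipticCurves.Rank1Residual.Typed
  Summit.BirchSwinnertonDyer.Rank1Residual
  Summit.BirchSwinnertonDyer.Rank1Residual.P2
  Summit.BirchSwinnertonDyer.BirchSwinnertonDyer.Theorems.AddPotGoodPrint
  Summit.BirchSwinnertonDyer.BirchSwinnertonDyer.Theorems.OrdinaryTwistAtTwo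

namespace Summit.BirchSwinnertonDyer.BirchSwinnertonDyer.Theorems.GenusExact.TwinSwap.KrizLiAnchorWall

/-! ## §1 Good supersingular reduction at `2` travels along twists by `d ≡ 1 (mod 4)`; even `a₁` means supersingular -/

/-- **`GoodSS` at `2` passes to every global minimal model of a twist by `d ≡ 1 (mod 4)`**: good reduction passes
(`hasGoodReductionAtPrime_two_of_smul_quadraticTwist_of_emod_four_eq_one`) and ordinarity is invariant
(`isOrdinaryAt_two_iff_of_smul_quadraticTwist_of_emod_four_eq_one`), so non-ordinary stays non-ordinary (`a₂(V^{(d)}) = ±a₂(V)`).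
[cite: SilvermanAEC2009, V.4 and X.2 Prop. 2.4] [cite: Pal2012, Prop. 2.5] -/
theorem goodSS_two_of_smul_quadraticTwist_of_emod_four_eq_one
    (V W : WeierstrassCurve ℚ) [V.IsElliptic] [V.IsGloballyMinimal] [W.IsElliptic] [W.IsGloballyMinimal]
    {d : ℤ} (hd4 : d % 4 = 1) {C : VariableChange ℚ} (hC : C • V.quadraticTwist (d : ℚ) = W)
    (hV : haveI : Fact (Nat.Prime 2) := ⟨Nat.prime_two⟩; GoodSS V 2) :
    haveI : Fact (Nat.Prime 2) := ⟨Nat.prime_two⟩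
    GoodSS W 2 := by
  haveI : Fact (Nat.Prime 2) := ⟨Nat.prime_two⟩
  have hgoodW : W.HasGoodReductionAtPrime 2 := hasGoodReductionAtPrime_two_of_smul_quadraticTwist_of_emod_four_eq_one V W hd4 hC hV.1
  refine ⟨hgoodW, ?_⟩
  by_contra hndvd
  have hordW : IsOrdinaryAt W 2 := ⟨hgoodW, hndvd⟩
  have hordV : IsOrdinaryAt V 2 := (isOrdinaryAt_two_iff_of_smul_quadraticTwist_of_emod_four_eq_one V W hd4 hC).mp hordW
  exact hordV.2 hV.2

/-- **Even `a₁` on the minimal integer model + good reduction at `2` ⟹ good SUPERSINGULAR at `2`** (in characteristic `2`, ordinary ⟺ `a₁ ≠ 0`,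
i.e. `a₁` odd on a minimal equation; `OrdinaryTwistAtTwo.isOrdinaryAt_two_iff_odd_a₁`). [cite: SilvermanAEC2009, V.4 (first paragraph) and App. A Prop. 1.1] -/
theorem goodSS_two_of_even_a₁ (V : WeierstrassCurve ℚ) [V.IsElliptic] [V.IsGloballyMinimal]
    (hgood : haveI : Fact (Nat.Prime 2) := ⟨Nat.prime_two⟩; V.HasGoodReductionAtPrime 2) (ha₁ : Even (integralModelInt V).a₁) :
    haveI : Fact (Nat.Prime 2) := ⟨Nat.prime_two⟩
    GoodSS V 2 := by
  haveI : Fact (Nat.Prime 2) := ⟨Nat.prime_two⟩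
  refine ⟨hgood, ?_⟩
  by_contra hndvd
  have hodd : Odd (integralModelInt V).a₁ := (isOrdinaryAt_two_iff_odd_a₁ V hgood).mp ⟨hgood, hndvd⟩
  exact (Int.not_odd_iff_even.mpr ha₁) hodd

/-! ## §2 The road keyed on the supersingular wall row alone -/

variable (V : WeierstrassCurve ℚ) [V.IsElliptic] [V.IsGloballyMinimal] [NeZero (V.conductorNorm ℤ)]

/-- ★ **THE KRIZ–LI ANCHOR ROAD KEYED ON THE SUPERSINGULAR WALL ROW — `BSD(W′, 2)` at every global minimal `W′ ≅ V^{(d)}` or `≅ V^{(d·d_K)}`,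
`d ∈ 𝒩(V, K)`, `χ_d(−N) = 1`**, from: `hSS` (`BSD₂` for every non-CM global minimal curve of analytic rank `0` that is good supersingular at `2` —
WALL item 19097 unfolded), `GoodSS V 2`, `d_K ≡ 1 (mod 4)`, `N(V) < 5000`, `¬CM(V)`, `r_an(V) = 1`, `V(ℚ)[2] = 0`, the Heegner field, the (★)-datum,
Kriz–Li's local clause.  The companion is non-CM, of analytic rank `0`, good supersingular at `2` (§1).  BY NAME: Thm 5.1 (2), Thm 4.3, Creutz–Miller.
CONDITIONAL on `hSS`; BSD is not proved by any of this. [cite: KrizLi2019, Thm. 5.1 (2) and Thm. 4.3] [cite: CreutzMiller2012, Thm. 1.1] -/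
theorem krizLi_bsdp_two_of_twist_of_conductor_lt_of_ssWall (hKL : KrizLi2019.thm112_bsdTwo_twist)
    (h33 : KrizLi2019.thm33_rank_twist) (hS31 : bsdTriple_of_analyticRank_le_one_of_conductor_lt)
    (hSS : ∀ (W : WeierstrassCurve ℚ) [W.IsElliptic] [W.IsGloballyMinimal], ¬ W.HasCM → W.analyticRank = 0 →
      (haveI : Fact (Nat.Prime 2) := ⟨Nat.prime_two⟩; GoodSS W 2) → BSDp W 2)
    (hV : haveI : Fact (Nat.Prime 2) := ⟨Nat.prime_two⟩; GoodSS V 2)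
    (hN : V.conductorNorm ℤ < 5000) (hcm : ¬ V.HasCM) (hr : V.analyticRank = 1)
    (h2 : ∀ Q : V.toAffine.Point, 2 • Q = 0 → Q = 0)
    (K : Type) [Field K] [NumberField K] (hK : IsImaginaryQuadratic K) (hdK4 : NumberField.discr K % 4 = 1)
    (hH : SatisfiesHeegnerHypothesis (V.conductorNorm ℤ) K)
    (Dt : ModularParametrizationData V (V.conductorNorm ℤ)) (H : HeegnerDatum (V.conductorNorm ℤ) (NumberField.discr K))
    (ι : K →+* ℂ) (P : (V.baseChange K).toAffine.Point) (hP : WeierstrassCurve.Affine.Point.map ι.toRatAlgHom P = heegnerPointComplex Dt H)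
    (j : K →ₐ[ℚ] ℚ_[2]) (hstar : KrizLi2019.AssumptionStar V Dt K P j)
    (hloc : (haveI : Fact (2 : ℕ).Prime := ⟨Nat.prime_two⟩;
      Odd ((V.baseChange ℚ_[2]).localTamagawaNumber ℤ_[2]) ∧
        (¬ V.HasGoodReductionAtPrime 2 → ¬ V.HasMultiplicativeReductionAtPrime 2 → Odd Dt.c)))
    {d : ℤ} (hd : KrizLi2019.InN V K d) (hsign : Int.sign d * jacobiSym (V.conductorNorm ℤ) d.natAbs = 1)
    (W' : WeierstrassCurve ℚ) [W'.IsElliptic] [W'.IsGloballyMinimal]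
    (hW' : (∃ C : VariableChange ℚ, C • V.quadraticTwist (d : ℚ) = W') ∨
      (∃ C : VariableChange ℚ, C • V.quadraticTwist ((d * NumberField.discr K : ℤ) : ℚ) = W')) :
    BSDp W' 2 := by
  have hD : (NumberField.discr K : ℚ) ≠ 0 := by exact_mod_cast NumberField.discr_ne_zero K
  obtain ⟨W₀, _, _, hW₀⟩ := exists_globallyMinimal_twist V hD
  have hr0 : W₀.analyticRank = 0 :=
    krizLi_analyticRank_partner_eq_zero_of_rankOne V h33 h2 K hK hH Dt H ι P hP j hstar hr W₀ hW₀
  have hcm0 : ¬ W₀.HasCM := not_hasCM_of_smul_quadraticTwist V hcm hD W₀ hW₀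
  obtain ⟨C₀, hC₀⟩ := hW₀
  have hss0 := goodSS_two_of_smul_quadraticTwist_of_emod_four_eq_one V W₀ hdK4 hC₀ hV
  exact krizLi_bsdp_two_of_twist_of_conductor_lt_of_partner_bsdp V hKL h33 hS31 hN h2 K hK hH Dt H ι P hP j hstar hloc W₀ ⟨C₀, hC₀⟩
    (hSS W₀ hcm0 hr0 hss0) hd hsign W' hW'

/-! ## §3 The U₂-keyed sorting under the supersingular wall row -/

/-- **THE RANK-ONE MEMBERS `V^{(d)}` modulo the SUPERSINGULAR wall row + PRINT + the anchor's (★)**: at every global minimal `W₁ ≅ V^{(d)}`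
(`d ∈ 𝒩(V, K)`, `χ_d(−N) = 1`): `r_an(W₁) = 1 ∧ ¬CM ∧ BSD(W₁, 2)`.  BSD is not proved by any of this; U₂ is not proved.
[cite: KrizLi2019, Thm. 5.1 (2), Thm. 4.3] [cite: CreutzMiller2012, Thm. 1.1] -/
theorem rankOneMembers_of_ssWall (hKL : KrizLi2019.thm112_bsdTwo_twist)
    (h33 : KrizLi2019.thm33_rank_twist) (hS31 : bsdTriple_of_analyticRank_le_one_of_conductor_lt)
    (hSS : ∀ (W : WeierstrassCurve ℚ) [W.IsElliptic] [W.IsGloballyMinimal], ¬ W.HasCM → W.analyticRank = 0 →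
      (haveI : Fact (Nat.Prime 2) := ⟨Nat.prime_two⟩; GoodSS W 2) → BSDp W 2)
    (hV : haveI : Fact (Nat.Prime 2) := ⟨Nat.prime_two⟩; GoodSS V 2)
    (hN : V.conductorNorm ℤ < 5000) (hcm : ¬ V.HasCM) (hr : V.analyticRank = 1)
    (h2 : ∀ Q : V.toAffine.Point, 2 • Q = 0 → Q = 0)
    (K : Type) [Field K] [NumberField K] (hK : IsImaginaryQuadratic K) (hdK4 : NumberField.discr K % 4 = 1)
    (hH : SatisfiesHeegnerHypothesis (V.conductorNorm ℤ) K)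
    (Dt : ModularParametrizationData V (V.conductorNorm ℤ)) (H : HeegnerDatum (V.conductorNorm ℤ) (NumberField.discr K))
    (ι : K →+* ℂ) (P : (V.baseChange K).toAffine.Point) (hP : WeierstrassCurve.Affine.Point.map ι.toRatAlgHom P = heegnerPointComplex Dt H)
    (j : K →ₐ[ℚ] ℚ_[2]) (hstar : KrizLi2019.AssumptionStar V Dt K P j)
    (hloc : (haveI : Fact (2 : ℕ).Prime := ⟨Nat.prime_two⟩;
      Odd ((V.baseChange ℚ_[2]).localTamagawaNumber ℤ_[2]) ∧
        (¬ V.HasGoodReductionAtPrime 2 → ¬ V.HasMultiplicativeReductionAtPrime 2 → Odd Dt.c)))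
    {d : ℤ} (hd : KrizLi2019.InN V K d) (hsign : Int.sign d * jacobiSym (V.conductorNorm ℤ) d.natAbs = 1)
    (W₁ : WeierstrassCurve ℚ) [W₁.IsElliptic] [W₁.IsGloballyMinimal]
    (hW₁ : ∃ C : VariableChange ℚ, C • V.quadraticTwist (d : ℚ) = W₁) :
    W₁.analyticRank = 1 ∧ ¬ W₁.HasCM ∧ BSDp W₁ 2 := by
  have hB : BSDp W₁ 2 := krizLi_bsdp_two_of_twist_of_conductor_lt_of_ssWall V hKL h33 hS31 hSS hV hN hcm hr h2 K hK hdK4 hH Dt H ι P hP j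
    hstar hloc hd hsign W₁ (Or.inl hW₁)
  have hD : (NumberField.discr K : ℚ) ≠ 0 := by exact_mod_cast NumberField.discr_ne_zero K
  have hd0 : (d : ℚ) ≠ 0 := cast_ne_zero_of_inN V hd
  have hdK0 : ((d * NumberField.discr K : ℤ) : ℚ) ≠ 0 := by push_cast; exact mul_ne_zero hd0 hD
  obtain ⟨W₂, _, _, hW₂⟩ := exists_globallyMinimal_twist V hdK0
  obtain ⟨-, heq⟩ := krizLi_analyticRank_twists V h33 h2 K hK hH Dt H ι P hP j hstar hd hsign W₁ W₂ hW₁ hW₂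
  exact ⟨by rw [heq, hr], not_hasCM_of_smul_quadraticTwist V hcm hd0 W₁ hW₁, hB⟩

/-- **THE RANK-ZERO COMPANIONS `V^{(d·d_K)}` under the supersingular wall row**: at every global minimal `W₂ ≅ V^{(d·d_K)}` (`d ∈ 𝒩(V, K)`,
`χ_d(−N) = 1`): `r_an(W₂) = 0 ∧ ¬CM ∧ GoodSS W₂ 2 ∧ BSD(W₂, 2)` — members of EXACTLY the class item 19097 quantifies over.  BSD is not proved by any
of this. [cite: KrizLi2019, Thm. 5.1 (2), Thm. 4.3] [cite: CreutzMiller2012, Thm. 1.1] -/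
theorem rankZeroCompanions_of_ssWall (hKL : KrizLi2019.thm112_bsdTwo_twist)
    (h33 : KrizLi2019.thm33_rank_twist) (hS31 : bsdTriple_of_analyticRank_le_one_of_conductor_lt)
    (hSS : ∀ (W : WeierstrassCurve ℚ) [W.IsElliptic] [W.IsGloballyMinimal], ¬ W.HasCM → W.analyticRank = 0 →
      (haveI : Fact (Nat.Prime 2) := ⟨Nat.prime_two⟩; GoodSS W 2) → BSDp W 2)
    (hV : haveI : Fact (Nat.Prime 2) := ⟨Nat.prime_two⟩; GoodSS V 2)
    (hN : V.conductorNorm ℤ < 5000) (hcm : ¬ V.HasCM) (hr : V.analyticRank = 1)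
    (h2 : ∀ Q : V.toAffine.Point, 2 • Q = 0 → Q = 0)
    (K : Type) [Field K] [NumberField K] (hK : IsImaginaryQuadratic K) (hdK4 : NumberField.discr K % 4 = 1)
    (hH : SatisfiesHeegnerHypothesis (V.conductorNorm ℤ) K)
    (Dt : ModularParametrizationData V (V.conductorNorm ℤ)) (H : HeegnerDatum (V.conductorNorm ℤ) (NumberField.discr K))
    (ι : K →+* ℂ) (P : (V.baseChange K).toAffine.Point) (hP : WeierstrassCurve.Affine.Point.map ι.toRatAlgHom P = heegnerPointComplex Dt H)
    (j : K →ₐ[ℚ] ℚ_[2]) (hstar : KrizLi2019.AssumptionStar V Dt K P j)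
    (hloc : (haveI : Fact (2 : ℕ).Prime := ⟨Nat.prime_two⟩;
      Odd ((V.baseChange ℚ_[2]).localTamagawaNumber ℤ_[2]) ∧
        (¬ V.HasGoodReductionAtPrime 2 → ¬ V.HasMultiplicativeReductionAtPrime 2 → Odd Dt.c)))
    {d : ℤ} (hd : KrizLi2019.InN V K d) (hsign : Int.sign d * jacobiSym (V.conductorNorm ℤ) d.natAbs = 1)
    (W₂ : WeierstrassCurve ℚ) [W₂.IsElliptic] [W₂.IsGloballyMinimal]
    (hW₂ : ∃ C : VariableChange ℚ, C • V.quadraticTwist ((d * NumberField.discr K : ℤ) : ℚ) = W₂) :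
    haveI : Fact (Nat.Prime 2) := ⟨Nat.prime_two⟩
    W₂.analyticRank = 0 ∧ ¬ W₂.HasCM ∧ GoodSS W₂ 2 ∧ BSDp W₂ 2 := by
  have hB : BSDp W₂ 2 := krizLi_bsdp_two_of_twist_of_conductor_lt_of_ssWall V hKL h33 hS31 hSS hV hN hcm hr h2 K hK hdK4 hH Dt H ι P hP j
    hstar hloc hd hsign W₂ (Or.inr hW₂)
  have hD : (NumberField.discr K : ℚ) ≠ 0 := by exact_mod_cast NumberField.discr_ne_zero K
  have hd0 : (d : ℚ) ≠ 0 := cast_ne_zero_of_inN V hd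
  have hdK0 : ((d * NumberField.discr K : ℤ) : ℚ) ≠ 0 := by push_cast; exact mul_ne_zero hd0 hD
  obtain ⟨W₁, _, _, hW₁⟩ := exists_globallyMinimal_twist V hd0
  obtain ⟨hor, heq⟩ := krizLi_analyticRank_twists V h33 h2 K hK hH Dt H ι P hP j hstar hd hsign W₁ W₂ hW₁ hW₂
  have hr2 : W₂.analyticRank = 0 := by omega
  have hdd4 : (d * NumberField.discr K) % 4 = 1 := by rw [Int.mul_emod, hd.1, hdK4]; decide
  obtain ⟨C₂, hC₂⟩ := hW₂
  have hss2 := goodSS_two_of_smul_quadraticTwist_of_emod_four_eq_one V W₂ hdd4 hC₂ hV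
  exact ⟨hr2, not_hasCM_of_smul_quadraticTwist V hcm hdK0 W₂ ⟨C₂, hC₂⟩, hss2, hB⟩

end Summit.BirchSwinnertonDyer.BirchSwinnertonDyer.Theorems.GenusExact.TwinSwap.KrizLiAnchorWall

end
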